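import Mathlib
import Summits.Ventures.PercRepro2.K5K3Kernel

/-!
# The `K₅` certificate of the typed `K₃` base at distinct marks (`b = 4`)
(blind cell PercRepro2, typer-1 g10)

One `decide +kernel`: `kNeg3 4 ≤ kPos3 4`, no borrow in the difference, digits of `kNeg3 4` below `2^19`
(`K5K3Kernel.lean`).  No `native_decide`, no data file.
-/

namespace Summit.Ventures.PercRepro2

namespace K5

set_option maxRecDepth 100000 in
/-- **The `K₅` certificate of the typed `K₃` base, distinct marks** `(o, a₁, a₂, a₃, b) = (0, 1, 2, 3, 4)`. -/
theorem cert3_4 : Cert3 4 := by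
  unfold Cert3
  decide +kernel

end K5

end Summit.Ventures.PercRepro2
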